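import Summits.Ventures.CertifiedQuantumChemistry.Rows.OrbitalRotationInvariance
import Literature.MathematicalPhysics.QuantumChemistry.RelaxationSymmetryAveraging
import HarnessLib

/-!
# Ventures/CertifiedQuantumChemistry — Rows/OrbitalRotationAveraging.lean: symmetry adaptation to ANY
# finite group of orbital rotations is LOSSLESS (Gatermann–Parrilo Thm 3.3 for unitary representations)

HONEST FRAMING (verbatim): certified bounds for a stated model Hamiltonian in a stated basis; not a
claim about the real molecule beyond that model.

Seat rdm-B, ROWS courtesy file (theorems only; no `def`, no notation); fourth part of the
orbital-rotation set and the 'NOT here: non-abelian point groups' item of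
`Rows/OrbitalSignBlockingLossless.lean`. The typer's `RelaxationSymmetryAveraging.lean` proves
Gatermann–Parrilo's Theorem 3.3 for groups acting by RELABELLINGS of the spin orbitals (permutation
representations `G →* Equiv.Perm (Orb Λ)`); a molecular point group, however, acts on a basis of
symmetry-UNADAPTED orbitals by general unitary matrices `D(g)` (rotations mixing degenerate partners),
not by permutations. With the invariance of the feasible sets under unitary rotations
(`isDQGFeasible_conj_unitary`, `isDQGFeasibleSector_conj_unitary`) the same Reynolds-operator argument
goes through for every finite group acting by a UNITARY REPRESENTATION `ρ : G →* Matrix (Orb Λ) (Orb Λ) ℂ`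
(`ρ(g) ρ(g)† = 1`; spin-preserving for the sector programme):

* `isDQGFeasible_rotationAverage`, `isDQGFeasibleSector_rotationAverage` — the group average
  `γ̄ = |G|⁻¹ Σ_g ρ(g) γ ρ(g)†`, `Γ̄ = |G|⁻¹ Σ_g (ρ(g)⊗ρ(g)) Γ (ρ(g)⊗ρ(g))†` of a feasible pair is
  feasible (invariance for each `g` + convexity, the typer's `IsDQGFeasible(Sector).sum_smul`);
* `rotationAverage_one_conj`, `rotationAverage_two_conj` — the average is `ρ`-INVARIANT
  (`ρ(g₀) γ̄ ρ(g₀)† = γ̄`: left translation permutes the summands, `ρ` is a homomorphism);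
* `rdmEnergy_rotationAverage` — the average has the same energy whenever the functional is
  `ρ`-invariant (hypothesis `hE`; affinity, the typer's `rdmEnergy_sum_smul`);
  `rdmEnergy_conj_eq_of_tables_invariant` — `hE` holds when each `ρ(g)` is the spin-free lift of a
  one-particle unitary `u_g` leaving the integral tables invariant (`h' = h`, `g' = g` in the sense of
  `rdmEnergy_conj_orbital`) — the molecular point group of an FCIDUMP;
* **`le_pqgEnergy_iff_rotationInvariant`**, **`le_pqgSectorEnergy_iff_rotationInvariant`** —
  THEOREM 3.3 for unitary representations: `c ≤ E_PQG` (resp. `E_PQG(N_α, N_β)`) iff `c` lies below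
  the functional on the `ρ`-INVARIANT feasible pairs only — restricting the programme to
  symmetry-adapted (block-diagonal by irreducible representation) pairs loses nothing, for abelian AND
  non-abelian point groups alike.

Everything is PROVED (0 sorry, standard axioms); no definitions, no named facts; nothing asserts a bound
about any model; no claim node, no hint / row depends on it. NOT here: the explicit block structure of
the invariant pairs (Schur's lemma / G–P §4–5), the `T1`/`T2′` rung.

References: K. Gatermann, P. A. Parrilo, J. Pure Appl. Algebra 192 (2004) 95–128, §3 Def. 3.1 /
Thm 3.3 (held copy PDF pp. 7–8; the definition is stated for a linear representation `σ : G → Aut(S^n)`,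
`σ(g)(X) = ρ(g)ᵀ X ρ(g)` — exactly the unitary congruences used here); D. A. Mazziotti, Adv. Chem.
Phys. 134 (2007) ch. 3 §II.F–G (spin and spatial symmetry adaptation of the 2-RDM).

Tree (REUSED): `IsDQGFeasible.sum_smul`, `IsDQGFeasibleSector.sum_smul`, `rdmEnergy_sum_smul`,
`le_pqgEnergy_iff`, `le_pqgSectorEnergy_iff` (typer); `isDQGFeasible_conj_unitary`,
`kronecker_mul_conjTranspose_of_unitary`, `isDQGFeasibleSector_conj_unitary`, `rdmEnergy_conj_orbital`,
`spin_sel_of_orbital` (this seat's rotation files). Mathlib: `Equiv.sum_comp`, `Equiv.mulLeft`,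
`map_mul`, `Matrix.conjTranspose_mul`, `Matrix.mul_kronecker_mul`.
-/

noncomputable section

namespace Summit.Ventures.CertifiedQuantumChemistry

open Matrix Finset
open Literature.MathematicalPhysics.QuantumLattice Literature.MathematicalPhysics.QuantumChemistry
open scoped ComplexOrder Kronecker

variable {Λ : Type*} [LinearOrder Λ] [Fintype Λ]
variable {G : Type*} [Group G] [Fintype G]

/-- The uniform weights `1/|G|` sum to one. -/
private theorem sum_card_inv_eq_one' : ∑ _g : G, ((Fintype.card G : ℝ)⁻¹ : ℝ) = 1 := by
  rw [Finset.sum_const, Finset.card_univ, nsmul_eq_mul,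
    mul_inv_cancel₀ (Nat.cast_ne_zero.mpr (Fintype.card_pos_iff.mpr ⟨1⟩).ne')]

/-! ## §1 The group average of a feasible pair is feasible -/

/-- **The rotation average of a DQG-feasible pair is DQG-feasible** (`N`-electron programme; any
finite group acting by unitaries `ρ(g)`, `ρ(g) ρ(g)† = 1`). -/
theorem isDQGFeasible_rotationAverage (ρ : G →* Matrix (Orb Λ) (Orb Λ) ℂ) (hρ : ∀ g, ρ g * (ρ g)ᴴ = 1)
    {N : ℕ} {γ : Matrix (Orb Λ) (Orb Λ) ℂ} {Γ : Matrix (Orb Λ × Orb Λ) (Orb Λ × Orb Λ) ℂ}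
    (h : IsDQGFeasible N γ Γ) :
    IsDQGFeasible N (∑ g : G, (((Fintype.card G : ℝ)⁻¹ : ℝ) : ℂ) • (ρ g * γ * (ρ g)ᴴ))
      (∑ g : G, (((Fintype.card G : ℝ)⁻¹ : ℝ) : ℂ) • (ρ g ⊗ₖ ρ g * Γ * (ρ g ⊗ₖ ρ g)ᴴ)) :=
  IsDQGFeasible.sum_smul Finset.univ (fun _ => (Fintype.card G : ℝ)⁻¹)
    (fun _ _ => inv_nonneg.mpr (Nat.cast_nonneg _)) sum_card_inv_eq_one'
    fun g _ => isDQGFeasible_conj_unitary (hρ g) h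

/-- **The rotation average of a sector-feasible pair is sector-feasible** (spin-preserving
unitaries). -/
theorem isDQGFeasibleSector_rotationAverage (ρ : G →* Matrix (Orb Λ) (Orb Λ) ℂ)
    (hρ : ∀ g, ρ g * (ρ g)ᴴ = 1) (hspin : ∀ g (i k : Orb Λ), (ofLex i).2 ≠ (ofLex k).2 → ρ g i k = 0)
    {a b : ℕ} {γ : Matrix (Orb Λ) (Orb Λ) ℂ} {Γ : Matrix (Orb Λ × Orb Λ) (Orb Λ × Orb Λ) ℂ}
    (h : IsDQGFeasibleSector a b γ Γ) :
    IsDQGFeasibleSector a b (∑ g : G, (((Fintype.card G : ℝ)⁻¹ : ℝ) : ℂ) • (ρ g * γ * (ρ g)ᴴ))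
      (∑ g : G, (((Fintype.card G : ℝ)⁻¹ : ℝ) : ℂ) • (ρ g ⊗ₖ ρ g * Γ * (ρ g ⊗ₖ ρ g)ᴴ)) :=
  IsDQGFeasibleSector.sum_smul Finset.univ (fun _ => (Fintype.card G : ℝ)⁻¹)
    (fun _ _ => inv_nonneg.mpr (Nat.cast_nonneg _)) sum_card_inv_eq_one'
    fun g _ => isDQGFeasibleSector_conj_unitary (hρ g) (hspin g) h

/-! ## §2 The average is invariant and has the same energy -/

/-- **The averaged 1-matrix is `ρ`-invariant**: `ρ(g₀) γ̄ ρ(g₀)† = γ̄` (left translation by `g₀`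
permutes the summands). -/
theorem rotationAverage_one_conj (ρ : G →* Matrix (Orb Λ) (Orb Λ) ℂ) (c : ℂ)
    (γ : Matrix (Orb Λ) (Orb Λ) ℂ) (g₀ : G) :
    ρ g₀ * (∑ g : G, c • (ρ g * γ * (ρ g)ᴴ)) * (ρ g₀)ᴴ = ∑ g : G, c • (ρ g * γ * (ρ g)ᴴ) := by
  rw [Finset.mul_sum, Finset.sum_mul]
  calc ∑ g : G, ρ g₀ * (c • (ρ g * γ * (ρ g)ᴴ)) * (ρ g₀)ᴴ
      = ∑ g : G, c • (ρ (g₀ * g) * γ * (ρ (g₀ * g))ᴴ) := by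
        refine Finset.sum_congr rfl fun g _ => ?_
        rw [Matrix.mul_smul, Matrix.smul_mul, map_mul, conjTranspose_mul]
        simp only [Matrix.mul_assoc]
    _ = ∑ g : G, c • (ρ g * γ * (ρ g)ᴴ) :=
        Equiv.sum_comp (Equiv.mulLeft g₀) (fun g => c • (ρ g * γ * (ρ g)ᴴ))

/-- **The averaged 2-matrix is `ρ`-invariant.** -/
theorem rotationAverage_two_conj (ρ : G →* Matrix (Orb Λ) (Orb Λ) ℂ) (c : ℂ)
    (Γ : Matrix (Orb Λ × Orb Λ) (Orb Λ × Orb Λ) ℂ) (g₀ : G) :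
    ρ g₀ ⊗ₖ ρ g₀ * (∑ g : G, c • (ρ g ⊗ₖ ρ g * Γ * (ρ g ⊗ₖ ρ g)ᴴ)) * (ρ g₀ ⊗ₖ ρ g₀)ᴴ =
      ∑ g : G, c • (ρ g ⊗ₖ ρ g * Γ * (ρ g ⊗ₖ ρ g)ᴴ) := by
  rw [Finset.mul_sum, Finset.sum_mul]
  calc ∑ g : G, ρ g₀ ⊗ₖ ρ g₀ * (c • (ρ g ⊗ₖ ρ g * Γ * (ρ g ⊗ₖ ρ g)ᴴ)) * (ρ g₀ ⊗ₖ ρ g₀)ᴴ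
      = ∑ g : G, c • (ρ (g₀ * g) ⊗ₖ ρ (g₀ * g) * Γ * (ρ (g₀ * g) ⊗ₖ ρ (g₀ * g))ᴴ) := by
        refine Finset.sum_congr rfl fun g _ => ?_
        rw [Matrix.mul_smul, Matrix.smul_mul, map_mul, mul_kronecker_mul, conjTranspose_mul]
        simp only [Matrix.mul_assoc]
    _ = ∑ g : G, c • (ρ g ⊗ₖ ρ g * Γ * (ρ g ⊗ₖ ρ g)ᴴ) :=
        Equiv.sum_comp (Equiv.mulLeft g₀) (fun g => c • (ρ g ⊗ₖ ρ g * Γ * (ρ g ⊗ₖ ρ g)ᴴ))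

/-- **The average has the same energy** when the functional is `ρ`-invariant (condition (ii)). -/
theorem rdmEnergy_rotationAverage (h : Λ → Λ → ℂ) (g₂ : Λ → Λ → Λ → Λ → ℂ) (hnuc : ℂ)
    (ρ : G →* Matrix (Orb Λ) (Orb Λ) ℂ)
    (hE : ∀ (g : G) (γ : Matrix (Orb Λ) (Orb Λ) ℂ) (Γ : Matrix (Orb Λ × Orb Λ) (Orb Λ × Orb Λ) ℂ),
      rdmEnergy h g₂ hnuc (ρ g * γ * (ρ g)ᴴ) (ρ g ⊗ₖ ρ g * Γ * (ρ g ⊗ₖ ρ g)ᴴ) =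
        rdmEnergy h g₂ hnuc γ Γ)
    (γ : Matrix (Orb Λ) (Orb Λ) ℂ) (Γ : Matrix (Orb Λ × Orb Λ) (Orb Λ × Orb Λ) ℂ) :
    rdmEnergy h g₂ hnuc (∑ g : G, (((Fintype.card G : ℝ)⁻¹ : ℝ) : ℂ) • (ρ g * γ * (ρ g)ᴴ))
        (∑ g : G, (((Fintype.card G : ℝ)⁻¹ : ℝ) : ℂ) • (ρ g ⊗ₖ ρ g * Γ * (ρ g ⊗ₖ ρ g)ᴴ)) =
      rdmEnergy h g₂ hnuc γ Γ := by
  have hw : ∑ _g : G, (((Fintype.card G : ℝ)⁻¹ : ℝ) : ℂ) = 1 := by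
    rw [← Complex.ofReal_sum, sum_card_inv_eq_one', Complex.ofReal_one]
  rw [rdmEnergy_sum_smul]
  simp_rw [hE]
  rw [← Finset.sum_mul, hw, one_mul, sub_self, zero_mul, add_zero]

omit [LinearOrder Λ] in
/-- **Condition (ii) from the integral tables.** If each `ρ(g)` is the spin-free lift of a
one-particle matrix `u_g` whose rotation leaves the integral tables invariant
(`Σ_{pq} u_{pa} ū_{qb} h_{pq} = h_{ab}`, `Σ_{pqrs} u_{pa} ū_{qb} u_{rc} ū_{sd} g_{pqrs} = g_{abcd}` — the
point group of the model), the energy functional is `ρ`-invariant. -/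
theorem rdmEnergy_conj_eq_of_tables_invariant (h : Λ → Λ → ℂ) (g₂ : Λ → Λ → Λ → Λ → ℂ) (hnuc : ℂ)
    {U : Matrix (Orb Λ) (Orb Λ) ℂ} {u : Matrix Λ Λ ℂ}
    (hUu : ∀ p q σ τ, U (orb p σ) (orb q τ) = if σ = τ then u p q else 0)
    (hh : ∀ a b, ∑ p, ∑ q, u p a * star (u q b) * h p q = h a b)
    (hg : ∀ a b c d, ∑ p, ∑ q, ∑ r, ∑ s, u p a * star (u q b) * u r c * star (u s d) * g₂ p q r s =
      g₂ a b c d)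
    (γ : Matrix (Orb Λ) (Orb Λ) ℂ) (Γ : Matrix (Orb Λ × Orb Λ) (Orb Λ × Orb Λ) ℂ) :
    rdmEnergy h g₂ hnuc (U * γ * Uᴴ) (U ⊗ₖ U * Γ * (U ⊗ₖ U)ᴴ) = rdmEnergy h g₂ hnuc γ Γ := by
  rw [rdmEnergy_conj_orbital hUu]
  simp only [hh, hg]

/-! ## §3 Theorem 3.3 for unitary representations -/

/-- **Gatermann–Parrilo Thm 3.3 for the DQG programme under a finite group of unitary orbital
rotations (`N`-electron form).** If the functional is `ρ`-invariant, a number lies below `E(γ, Γ)` on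
the whole DQG-feasible set — i.e. `c ≤ E_PQG` — iff it lies below it on the `ρ`-INVARIANT feasible
pairs only (`N ≤ 2|Λ|`). -/
theorem le_pqgEnergy_iff_rotationInvariant (h : Λ → Λ → ℂ) (g₂ : Λ → Λ → Λ → Λ → ℂ) (hnuc : ℂ)
    {N : ℕ} (hN : N ≤ Fintype.card (Orb Λ)) (ρ : G →* Matrix (Orb Λ) (Orb Λ) ℂ)
    (hρ : ∀ g, ρ g * (ρ g)ᴴ = 1)
    (hE : ∀ (g : G) (γ : Matrix (Orb Λ) (Orb Λ) ℂ) (Γ : Matrix (Orb Λ × Orb Λ) (Orb Λ × Orb Λ) ℂ),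
      rdmEnergy h g₂ hnuc (ρ g * γ * (ρ g)ᴴ) (ρ g ⊗ₖ ρ g * Γ * (ρ g ⊗ₖ ρ g)ᴴ) =
        rdmEnergy h g₂ hnuc γ Γ) (c : ℝ) :
    c ≤ pqgEnergy h g₂ hnuc N ↔
      ∀ γ Γ, IsDQGFeasible N γ Γ →
        (∀ g : G, ρ g * γ * (ρ g)ᴴ = γ ∧ ρ g ⊗ₖ ρ g * Γ * (ρ g ⊗ₖ ρ g)ᴴ = Γ) →
        c ≤ (rdmEnergy h g₂ hnuc γ Γ).re := by
  rw [le_pqgEnergy_iff h g₂ hnuc hN]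
  refine ⟨fun hc γ Γ hf _ => hc γ Γ hf, fun hc γ Γ hf => ?_⟩
  rw [← rdmEnergy_rotationAverage h g₂ hnuc ρ hE γ Γ]
  exact hc _ _ (isDQGFeasible_rotationAverage ρ hρ hf) fun g =>
    ⟨rotationAverage_one_conj ρ _ γ g, rotationAverage_two_conj ρ _ Γ g⟩

/-- **Gatermann–Parrilo Thm 3.3 for the sector programme under a finite group of spin-preserving
unitary orbital rotations.** `c ≤ E_PQG(N_α, N_β)` iff `c` lies below the functional on the
`ρ`-INVARIANT sector-feasible pairs (`a, b ≤ |Λ|`): symmetry adaptation to the full (possibly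
non-abelian) point group loses nothing. -/
theorem le_pqgSectorEnergy_iff_rotationInvariant (h : Λ → Λ → ℂ) (g₂ : Λ → Λ → Λ → Λ → ℂ)
    (hnuc : ℂ) {a b : ℕ} (ha : a ≤ Fintype.card Λ) (hb : b ≤ Fintype.card Λ)
    (ρ : G →* Matrix (Orb Λ) (Orb Λ) ℂ) (hρ : ∀ g, ρ g * (ρ g)ᴴ = 1)
    (hspin : ∀ g (i k : Orb Λ), (ofLex i).2 ≠ (ofLex k).2 → ρ g i k = 0)
    (hE : ∀ (g : G) (γ : Matrix (Orb Λ) (Orb Λ) ℂ) (Γ : Matrix (Orb Λ × Orb Λ) (Orb Λ × Orb Λ) ℂ),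
      rdmEnergy h g₂ hnuc (ρ g * γ * (ρ g)ᴴ) (ρ g ⊗ₖ ρ g * Γ * (ρ g ⊗ₖ ρ g)ᴴ) =
        rdmEnergy h g₂ hnuc γ Γ) (c : ℝ) :
    c ≤ pqgSectorEnergy h g₂ hnuc a b ↔
      ∀ γ Γ, IsDQGFeasibleSector a b γ Γ →
        (∀ g : G, ρ g * γ * (ρ g)ᴴ = γ ∧ ρ g ⊗ₖ ρ g * Γ * (ρ g ⊗ₖ ρ g)ᴴ = Γ) →
        c ≤ (rdmEnergy h g₂ hnuc γ Γ).re := by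
  rw [le_pqgSectorEnergy_iff h g₂ hnuc ha hb]
  refine ⟨fun hc γ Γ hf _ => hc γ Γ hf, fun hc γ Γ hf => ?_⟩
  rw [← rdmEnergy_rotationAverage h g₂ hnuc ρ hE γ Γ]
  exact hc _ _ (isDQGFeasibleSector_rotationAverage ρ hρ hspin hf) fun g =>
    ⟨rotationAverage_one_conj ρ _ γ g, rotationAverage_two_conj ρ _ Γ g⟩

/-- **An invariant minimiser exists** (sector form): with the typer's attainment theorem, the
optimal value `E_PQG(N_α, N_β)` is attained at a `ρ`-INVARIANT sector-feasible pair. -/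
theorem exists_rotationInvariant_rdmEnergy_eq_pqgSectorEnergy (h : Λ → Λ → ℂ)
    (g₂ : Λ → Λ → Λ → Λ → ℂ) (hnuc : ℂ) {a b : ℕ} (ha : a ≤ Fintype.card Λ) (hb : b ≤ Fintype.card Λ)
    (ρ : G →* Matrix (Orb Λ) (Orb Λ) ℂ) (hρ : ∀ g, ρ g * (ρ g)ᴴ = 1)
    (hspin : ∀ g (i k : Orb Λ), (ofLex i).2 ≠ (ofLex k).2 → ρ g i k = 0)
    (hE : ∀ (g : G) (γ : Matrix (Orb Λ) (Orb Λ) ℂ) (Γ : Matrix (Orb Λ × Orb Λ) (Orb Λ × Orb Λ) ℂ),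
      rdmEnergy h g₂ hnuc (ρ g * γ * (ρ g)ᴴ) (ρ g ⊗ₖ ρ g * Γ * (ρ g ⊗ₖ ρ g)ᴴ) =
        rdmEnergy h g₂ hnuc γ Γ) :
    ∃ γ Γ, IsDQGFeasibleSector a b γ Γ ∧
      (∀ g : G, ρ g * γ * (ρ g)ᴴ = γ ∧ ρ g ⊗ₖ ρ g * Γ * (ρ g ⊗ₖ ρ g)ᴴ = Γ) ∧
      (rdmEnergy h g₂ hnuc γ Γ).re = pqgSectorEnergy h g₂ hnuc a b := by
  obtain ⟨γ, Γ, hf, hEq⟩ := exists_isDQGFeasibleSector_rdmEnergy_eq_pqgSectorEnergy h g₂ hnuc ha hb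
  exact ⟨_, _, isDQGFeasibleSector_rotationAverage ρ hρ hspin hf,
    fun g => ⟨rotationAverage_one_conj ρ _ γ g, rotationAverage_two_conj ρ _ Γ g⟩,
    by rw [rdmEnergy_rotationAverage h g₂ hnuc ρ hE γ Γ, hEq]⟩

end Summit.Ventures.CertifiedQuantumChemistry

end
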